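import Mathlib
import Literature.Computability.Complexity.RangeAvoidance
import Literature.Computability.Complexity.SignDegreeXor
import Summits.PneNP.PneNP.Theorems.IP3ExpandingModel
import Summits.PneNP.PneNP.Theorems.IP3ExpandingCount

/-!
# Random pure `IP₃` instances at ratio `15/4`, I: the union bound (cell `pnp-ideate`, ROUND-23 residue w23e)

FRONTIER range-avoidance ladder, rung F-N3 context (restricted-model combinatorics — nothing here bears on `P` vs `NP`).

The `k = 6` pairwise SA+SDP hub `PairwiseSA.pairwiseSASDPLinearLevel` needs the gate `(3k−7)·b < 3a`, i.e. `11b < 3a` at `k = 6`;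
the ROUND-22 supply `IP3ExpandingExist.expandingIP3Exist` delivers ratio `7/2` (`22 > 21`, one unit short), so the corollary
«COR-A + SDP₂ at `k = 6`» needs a re-run of the first-moment count at ratio `15/4` (`44 < 45`).  This file is that count, verbatim
`IP3ExpandingCount` with the vertex threshold moved from `19/4` to `39/8`: `bad154 r ω` (some `≤ r` outputs `J` read fewer than
`39/8·|J|` variables), `boundaryExpandingQ154_of_not_bad` (`8|N(J)| ≥ 39|J|` ⇒ `4|bdry J| ≥ 8|N(J)| − 24|J| ≥ 15|J|`), the threshold
`v154 s = 5s − ⌈s/8⌉ ≥ ⌊(39s−1)/8⌋`, the containment `badSet154_subset` and the union bound `card_badSet154_le` over the cylinders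
`IP3ExpandingCount.cyl6`.  Parts II–IV: `IP3OverlapCount` (few output pairs share two variables), `IP3Expanding154Exist` (term estimate,
exponent `1/8`, radius `N/(5L⁸)`), `IP3Expanding154Supply` (alteration to simple overlaps; the `k = 6` SA+SDP corollary).
-/

set_option linter.dupNamespace false

open Finset Literature.Computability.Complexity
open Summit.PneNP.PneNP.Theorems.PstarSALevel (bdry)
open Summit.PneNP.PneNP.Theorems.PstarSASDPLevel (BoundaryExpandingQ)
open Summit.PneNP.PneNP.Theorems.PstarSAClosure (nbhd)
open Summit.PneNP.PneNP.Theorems.PstarExpandingModel (two_card_nbhd_le)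
open Summit.PneNP.PneNP.Theorems.IP3ExpandingModel
open Summit.PneNP.PneNP.Theorems.IP3ExpandingCount (cyl6 mem_cyl6 card_cyl6 card_cyl6_le)

namespace Summit.PneNP.PneNP.Theorems.IP3Expanding154Count

variable {N m : ℕ}

/-! ## Bad outcomes at ratio `15/4` -/

/-- An outcome is BAD at radius `r` if some `≤ r` outputs read fewer than `39/8` variables each on average. -/
def bad154 (r : ℕ) (ω : Outcome6 N m) : Prop :=
  ∃ J : Finset (Fin m), J.card ≤ r ∧ ¬(39 * J.card ≤ 8 * (nbhd (inst6 ω) J).card)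

/-- **Vertex expansion `39/8` ⇒ `(r, 15/4)`-boundary expansion** for `6`-local instances with injective positions. -/
theorem boundaryExpandingQ154_of_vertexExpanding (I : LocalMap 6 N m) (hI : ∀ j, Function.Injective (I.vars j)) (r : ℕ)
    (h : ∀ J : Finset (Fin m), J.card ≤ r → 39 * J.card ≤ 8 * (nbhd I J).card) : BoundaryExpandingQ 15 4 r I := by
  intro J hJ
  have h1 := h J hJ
  have h2 := two_card_nbhd_le I hI J
  omega

/-- A good outcome gives an `(r, 15/4)`-boundary expanding instance. -/
theorem boundaryExpandingQ154_of_not_bad (r : ℕ) (ω : Outcome6 N m) (h : ¬bad154 r ω) :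
    BoundaryExpandingQ 15 4 r (inst6 ω) := by
  refine boundaryExpandingQ154_of_vertexExpanding (inst6 ω) (fun j => (ω j).injective) r fun J hJ => ?_
  by_contra hlt
  exact h ⟨J, hJ, hlt⟩

/-- The threshold `v154 s = 5s − ⌈s/8⌉` (an upper bound for `⌊(39s−1)/8⌋`). -/
def v154 (s : ℕ) : ℕ := 5 * s - (s + 7) / 8

/-- `v154 s + ⌈s/8⌉ = 5s`. -/
theorem v154_add (s : ℕ) : v154 s + (s + 7) / 8 = 5 * s := by unfold v154; omega

/-- A bad set of size `s` reads at most `v154 s` variables. -/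
theorem le_v154_of_lt {s V : ℕ} (h : ¬(39 * s ≤ 8 * V)) : V ≤ v154 s := by unfold v154; omega

/-- `v154 s ≤ 5s`. -/
theorem v154_le (s : ℕ) : v154 s ≤ 5 * s := by unfold v154; omega

/-! ## The containment of the bad set -/

/-- The bad outcomes. -/
noncomputable def badSet154 (N m r : ℕ) : Finset (Outcome6 N m) := by
  classical exact univ.filter fun ω => bad154 r ω

/-- The covering family: over sizes `s = i + 1`, `i < r`, sets `J` of that size and vertex sets of size `v154 s`. -/
noncomputable def cover154 (N m r : ℕ) : Finset (Outcome6 N m) :=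
  (Finset.range r).biUnion fun i => ((univ : Finset (Fin m)).powersetCard (i + 1)).biUnion fun J =>
    ((univ : Finset (Fin N)).powersetCard (v154 (i + 1))).biUnion fun A => cyl6 J A

/-- **Containment**: if `5r ≤ N`, every bad outcome lies in the cover. -/
theorem badSet154_subset (r : ℕ) (hr : 5 * r ≤ N) : badSet154 N m r ⊆ cover154 N m r := by
  classical
  intro ω hω
  simp only [badSet154, Finset.mem_filter, Finset.mem_univ, true_and] at hω
  obtain ⟨J, hJr, hJ⟩ := hω
  have hs : 1 ≤ J.card := by
    rw [Nat.one_le_iff_ne_zero]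
    intro h0
    rw [Finset.card_eq_zero] at h0
    subst h0
    exact hJ (by simp)
  have hV : (nbhd (inst6 ω) J).card ≤ v154 J.card := le_v154_of_lt hJ
  have hvN : v154 J.card ≤ N := (v154_le _).trans (by omega)
  obtain ⟨A, hA, hmem⟩ := exists_set_of_small_nbhd6 ω J (v154 J.card) hvN hV
  simp only [cover154, Finset.mem_biUnion, Finset.mem_range, Finset.mem_powersetCard]
  refine ⟨J.card - 1, by omega, J, ⟨Finset.subset_univ _, by omega⟩, A, ⟨Finset.subset_univ _, ?_⟩, mem_cyl6.2 hmem⟩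
  rw [hA]; congr 1; omega

/-! ## The union bound -/

/-- **The union bound.**  If `5r ≤ N` then
`|bad| ≤ Σ_{i<r} C(m, i+1)·C(N, v154(i+1))·(v154(i+1)⁶)^{i+1}·Q^{m−(i+1)}`. -/
theorem card_badSet154_le (r : ℕ) (hr : 5 * r ≤ N) :
    ((badSet154 N m r).card : ℝ) ≤ ∑ i ∈ Finset.range r,
      (m.choose (i + 1) : ℝ) * (N.choose (v154 (i + 1)) : ℝ) * (((v154 (i + 1) : ℕ) : ℝ) ^ 6) ^ (i + 1) *
        (Fintype.card (Fin 6 ↪ Fin N) : ℝ) ^ (m - (i + 1)) := by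
  classical
  have h0 : ((badSet154 N m r).card : ℝ) ≤ ((cover154 N m r).card : ℝ) := by
    exact_mod_cast Finset.card_le_card (badSet154_subset r hr)
  refine h0.trans ?_
  unfold cover154
  refine (Nat.cast_le.2 Finset.card_biUnion_le).trans ?_
  push_cast
  refine Finset.sum_le_sum fun i _ => ?_
  refine (Nat.cast_le (α := ℝ).2 Finset.card_biUnion_le).trans ?_
  push_cast
  have hJ : ∀ J ∈ (univ : Finset (Fin m)).powersetCard (i + 1),
      ((((univ : Finset (Fin N)).powersetCard (v154 (i + 1))).biUnion fun A => cyl6 J A).card : ℝ) ≤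
        (N.choose (v154 (i + 1)) : ℝ) * (((v154 (i + 1) : ℕ) : ℝ) ^ 6) ^ (i + 1) *
          (Fintype.card (Fin 6 ↪ Fin N) : ℝ) ^ (m - (i + 1)) := by
    intro J hJ
    rw [Finset.mem_powersetCard] at hJ
    refine (Nat.cast_le (α := ℝ).2 Finset.card_biUnion_le).trans ?_
    push_cast
    have hterm : ∀ A ∈ (univ : Finset (Fin N)).powersetCard (v154 (i + 1)), ((cyl6 J A).card : ℝ) ≤
        (((v154 (i + 1) : ℕ) : ℝ) ^ 6) ^ (i + 1) * (Fintype.card (Fin 6 ↪ Fin N) : ℝ) ^ (m - (i + 1)) := by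
      intro A hA
      rw [Finset.mem_powersetCard] at hA
      have := card_cyl6_le (m := m) J hA.2
      rwa [hJ.2] at this
    refine (Finset.sum_le_sum hterm).trans ?_
    rw [Finset.sum_const, nsmul_eq_mul, Finset.card_powersetCard, Finset.card_univ, Fintype.card_fin]
    exact le_of_eq (by ring)
  refine (Finset.sum_le_sum hJ).trans ?_
  have hc : ((univ : Finset (Fin m)).powersetCard (i + 1)).card = m.choose (i + 1) := by
    rw [Finset.card_powersetCard, Finset.card_univ, Fintype.card_fin]
  rw [Finset.sum_const, nsmul_eq_mul, hc]
  exact le_of_eq (by ring)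

end Summit.PneNP.PneNP.Theorems.IP3Expanding154Count
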